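import Literature.MathematicalPhysics.PowerSystems.LuriePostnikovSlabPositivity
import Literature.MathematicalPhysics.PowerSystems.LuriePostnikovSlabDualWitness
import HarnessLib

/-!
# A dual witness for the Lur'e–Postnikov POSITIVITY class: one PSD matrix ⇒ no `LPSlabCertificate`

`LuriePostnikovSlabPositivity` widened the slab/Popov certificate class of record
(`SlabCertificate`: `P − ε·1 ⪰ 0`) to the loop-transformed class `LPSlabCertificate`, whose coercivity
field is `P + Cᵀ·diag(λ_k a_k)·C − ε·1 ⪰ 0` — `P` itself may be indefinite and there is no sign rule
`λ_k > 0 ⇒ a_k ≥ 0` [Khalil2002, §7.1 loop transformation (Example 7.5) with §7.1.2 Theorem 7.3;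
Pai1981, §4.6 eq. (4.46)].  `LuriePostnikovSlabDualWitness` refutes the class of record by the weak
theorem of alternatives [BoydVandenberghe2004, §5.9.4 (5.96)–(5.98), Example 5.14]: a PSD dual matrix
`Z` whose Lagrangian `tr(Z·𝓛)` is positive on the whole certificate cone.  That argument bounds the
`P`-term `tr(P·W)` (`W = Z₁₁Aᵀ + AZ₁₁ − 2BZ₂₁`) below by `0` USING `P ⪰ 0`, which the wider class does
not have.  This module adapts the dual point to the wider cone:

* writing `P = L − Cᵀ·diag(λa)·C` with `L := lowerMatrix ⪰ 0`,
  `tr(P·W) = tr(L·W) − Σ_k λ_k a_k q_k ≥ −Σ_k λ_k a_k q_k`, `q_k := (C·W·Cᵀ)_kk = C_k W C_kᵀ`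
  (`dualLowerCoeff`; `q_k ≥ 0` because `W + Wᵀ ⪰ 0`), so the `λ_k`-coefficient of the Lagrangian
  becomes `2 s_k − a_k q_k` instead of `2 s_k`;
* `LPSlabDualWitness S a₀ b₀` — `Z ⪰ 0`, (D1) `W + Wᵀ ⪰ 0`, (D2) `t_k(a₀, b₀) ≥ 0`, and the NEW
  (D3′) `a₀_k · q_k ≤ 2 s_k` on EVERY channel (for `a_k ≤ a₀_k` and `q_k ≥ 0`,
  `2 s_k − a_k q_k ≥ 2 s_k − a₀_k q_k`), (D4) `a₀ < b₀`, `tr Z₁₁ > 0`;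
* `LPSlabCertificate.false_of_lpDualWitness` (+ `_of_null`, `_of_window_of_null`,
  `_of_exists_window`, set form `isEmpty_of_lpDualWitness`) — NO `LPSlabCertificate S` has sectors
  `a ≤ a₀`, `b₀ ≤ b`; window forms phrased with the sector hypothesis `hsec` of
  `LPSlabCertificate.well_subset_regionOfAttraction`, exactly as the instances of the class of record
  state theirs;
* `LPSlabDualWitness.toSlabDualWitness` — (D3′) implies (D3) on the channels `a₀_k ≥ 0`, so an
  LP witness is a witness against the class of record as well (`SlabCertificate.false_of_lpDualWitness`):
  consistent with `SlabCertificate.toLP` (old class ⊆ new class).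

No new facts: every statement below is a theorem.  Strong alternatives are NOT claimed; producing `Z`
is the SDP solver's job, the kernel only checks it (all fields decidable on rational data; on a
machine-reference presentation with `C·B = 0` the new functional is `q_k = 2 (C A Z₁₁ Cᵀ)_kk`).

## References
* [BoydVandenberghe2004] S. Boyd, L. Vandenberghe, *Convex Optimization*, CUP 2004 — §5.9.4
  «Theorems of alternatives» ((5.96)–(5.98): weak alternatives via the dual function) and
  Example 5.14 (feasibility of a linear matrix inequality) [held `book:boydnd-convex-optimization`,
  chunks p0238–p0239].
* [Khalil2002] H. K. Khalil, *Nonlinear Systems*, 3rd ed. — §7.1 (loop transformation, Example 7.5)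
  and §7.1.2 Theorem 7.3 (the Popov-type function whose quadratic part is `P + Cᵀ·diag(λa)·C` after
  the transformation) [galaxy:panama:393504903659633 p0196, p0202–p0204].
* [Pai1981] M. A. Pai, *Power System Stability* (North-Holland 1981) — §2.16 eqs. (2.63)–(2.64)
  (the certificate equations typed as `slabMatrix`), §4.6 eq. (4.46).
* [HornJohnson2013] R. A. Horn, C. R. Johnson, *Matrix Analysis*, 2nd ed. — §7.1 (7.1.1b),
  Observation 7.1.3.
-/

open Matrix Finset

namespace Literature.MathematicalPhysics.PowerSystems.LyapunovFunctionFamily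

variable {ι κ : Type*} [Fintype ι] [Fintype κ] [DecidableEq ι] [DecidableEq κ]

/-! ## §1 The new dual functional and the trace identity for the positivity block -/

section Functional

variable (S : System ι κ)

/-- The coefficient through which the positivity block `Cᵀ·diag(λ_k a_k)·C` of the wider class enters
the Lagrangian: `q_k := (C·W·Cᵀ)_kk = C_k W C_kᵀ` with `W = Z₁₁Aᵀ + AZ₁₁ − 2·BZ₂₁` (`dualAdjP`).
[cite: BoydVandenberghe2004, §5.9.4 (the dual function of (5.96)) and Example 5.14 (`tr(FᵢZ)`)] -/
def dualLowerCoeff (Z₁₁ : Matrix ι ι ℝ) (Z₂₁ : Matrix κ ι ℝ) (k : κ) : ℝ :=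
  (S.C * dualAdjP S Z₁₁ Z₂₁ * S.Cᵀ) k k

omit [Fintype ι] [DecidableEq ι] in
/-- `tr(M·diag d) = Σ_k M_kk d_k`. [folklore] -/
private theorem trace_mul_diagonal_lp (M : Matrix κ κ ℝ) (d : κ → ℝ) :
    trace (M * diagonal d) = ∑ k, M k k * d k := by
  simp only [Matrix.trace, Matrix.diag_apply, Matrix.mul_diagonal]

omit [DecidableEq ι] in
/-- **The positivity block in the Lagrangian**: `tr(Cᵀ·diag(d)·C · W) = Σ_k d_k · (C·W·Cᵀ)_kk`.
[cite: BoydVandenberghe2004, §5.9.4 (dual function of (5.96)); HornJohnson2013, §7.1 (cyclic trace)] -/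
theorem trace_lowerBlock_mul (d : κ → ℝ) (W : Matrix ι ι ℝ) :
    trace (S.Cᵀ * diagonal d * S.C * W) = ∑ k, d k * (S.C * W * S.Cᵀ) k k := by
  rw [show S.Cᵀ * diagonal d * S.C * W = (S.Cᵀ * diagonal d) * (S.C * W) by
        simp only [Matrix.mul_assoc],
    Matrix.trace_mul_comm,
    show S.C * W * (S.Cᵀ * diagonal d) = (S.C * W * S.Cᵀ) * diagonal d by
        simp only [Matrix.mul_assoc],
    trace_mul_diagonal_lp]
  exact Finset.sum_congr rfl fun k _ => mul_comm _ _

end Functional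

/-! ## §2 The dual witness against the positivity class -/

/-- **A dual witness against Lur'e–Postnikov POSITIVITY certificates with slopes `(a₀, b₀)`** for
`ẋ = Ax − BF(Cx)`: a positive semidefinite `Z = [[Z₁₁, Z₂₁ᵀ], [Z₂₁, Z₂₂]]` on `ι ⊕ κ` with (D1) the
`P`-coefficient `W + Wᵀ ⪰ 0`, (D2) every `τ_k`-coefficient `t_k(a₀, b₀) ≥ 0`, (D3′) on EVERY channel
`a₀_k · q_k ≤ 2 s_k` — the `λ_k`-coefficient `2 s_k − a_k q_k` of the Lagrangian over the wider cone
(`P = lowerMatrix − Cᵀ·diag(λa)·C`, `lowerMatrix ⪰ 0`) is then `≥ 0` for every `a_k ≤ a₀_k` — and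
(D4) `a₀ < b₀`, `tr Z₁₁ > 0`.  The point `λ ⪰_{K*} 0, λ ≠ 0, g(λ) ≥ 0` of the weak alternative to
«an `LPSlabCertificate` with sectors at least `[a₀, b₀]` exists»; all fields decidable on rational data.
[cite: BoydVandenberghe2004, §5.9.4 eqs. (5.97)–(5.98) (weak alternatives) and Example 5.14 (LMI feasibility); Khalil2002, §7.1 Example 7.5 with §7.1.2 Theorem 7.3 (the loop-transformed quadratic part `P + Cᵀ·diag(λa)·C`)] -/
structure LPSlabDualWitness (S : System ι κ) (a₀ b₀ : κ → ℝ) where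
  /-- state block of the dual matrix -/
  Z₁₁ : Matrix ι ι ℝ
  /-- channel × state block of the dual matrix -/
  Z₂₁ : Matrix κ ι ℝ
  /-- channel block of the dual matrix -/
  Z₂₂ : Matrix κ κ ℝ
  /-- `Z ⪰ 0` -/
  psd : (fromBlocks Z₁₁ Z₂₁ᵀ Z₂₁ Z₂₂).PosSemidef
  /-- (D1) the symmetrised `P`-coefficient is PSD -/
  adjP_psd : (dualAdjP S Z₁₁ Z₂₁ + (dualAdjP S Z₁₁ Z₂₁)ᵀ).PosSemidef
  /-- (D2) the `τ_k`-coefficients at the witness slopes are nonnegative -/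
  sectorCoeff_nonneg : ∀ k, 0 ≤ dualSectorCoeff S Z₁₁ Z₂₁ Z₂₂ a₀ b₀ k
  /-- (D3′) the `λ_k`-coefficients over the POSITIVITY cone are nonnegative: `a₀_k q_k ≤ 2 s_k` -/
  lowerPopovCoeff_le : ∀ k, a₀ k * dualLowerCoeff S Z₁₁ Z₂₁ k ≤ 2 * dualPopovCoeff S Z₂₁ Z₂₂ k
  /-- (D4a) nondegenerate sectors -/
  slope_lt : ∀ k, a₀ k < b₀ k
  /-- (D4b) `Z ≠ 0` in the direction that meets the strict constraint `η > 0` -/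
  trace_pos : 0 < trace Z₁₁

namespace LPSlabDualWitness

variable {S : System ι κ} {a₀ b₀ : κ → ℝ} (D : LPSlabDualWitness S a₀ b₀)

omit [DecidableEq ι] [DecidableEq κ] in
/-- `q_k = C_k W C_kᵀ ≥ 0`: twice it is the compression of `W + Wᵀ ⪰ 0` along `C_kᵀ`.
[cite: HornJohnson2013, §7.1 (7.1.1b) (`x*Ax ≥ 0`) with `x = C_kᵀ`] -/
theorem lowerCoeff_nonneg (k : κ) : 0 ≤ dualLowerCoeff S D.Z₁₁ D.Z₂₁ k := by
  have h := D.adjP_psd.dotProduct_mulVec_nonneg (S.C k)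
  rw [star_trivial, Matrix.add_mulVec, dotProduct_add] at h
  set W := dualAdjP S D.Z₁₁ D.Z₂₁ with hW
  have b1 : S.C k ⬝ᵥ (W *ᵥ S.C k) = (S.C * W * S.Cᵀ) k k := by
    simp only [Matrix.mul_apply, Matrix.transpose_apply, dotProduct, Matrix.mulVec,
      Finset.mul_sum, Finset.sum_mul]
    rw [Finset.sum_comm]
    exact Finset.sum_congr rfl fun j _ => Finset.sum_congr rfl fun i _ => by ring
  have b2 : S.C k ⬝ᵥ (Wᵀ *ᵥ S.C k) = (S.C * W * S.Cᵀ) k k := by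
    simp only [Matrix.mul_apply, Matrix.transpose_apply, dotProduct, Matrix.mulVec,
      Finset.mul_sum, Finset.sum_mul]
    exact Finset.sum_congr rfl fun i _ => Finset.sum_congr rfl fun j _ => by ring
  rw [b1, b2] at h
  unfold dualLowerCoeff
  linarith

omit [DecidableEq ι] [DecidableEq κ] in
/-- **(D3′) implies (D3) on first/third-quadrant channels**: `0 ≤ a₀_k` gives `0 ≤ a₀_k q_k ≤ 2 s_k`.
[cite: BoydVandenberghe2004, §5.9.4 (5.98)] -/
theorem popovCoeff_nonneg (k : κ) (hk : 0 ≤ a₀ k) : 0 ≤ dualPopovCoeff S D.Z₂₁ D.Z₂₂ k := by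
  have h1 := D.lowerPopovCoeff_le k
  have h2 := mul_nonneg hk (D.lowerCoeff_nonneg k)
  linarith

/-- **An LP witness is a witness against the class of record** (same blocks; (D3) from (D3′)).
[cite: BoydVandenberghe2004, §5.9.4 (5.97)–(5.98) and Example 5.14] -/
def toSlabDualWitness : SlabDualWitness S a₀ b₀ where
  Z₁₁ := D.Z₁₁
  Z₂₁ := D.Z₂₁
  Z₂₂ := D.Z₂₂
  psd := D.psd
  adjP_psd := D.adjP_psd
  sectorCoeff_nonneg := D.sectorCoeff_nonneg
  popovCoeff_nonneg := D.popovCoeff_nonneg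
  slope_lt := D.slope_lt
  trace_pos := D.trace_pos

omit [DecidableEq ι] in
/-- Slope monotonicity of the sector coefficient (inherited from the class-of-record witness):
`t_k(a, b) ≥ 0` for every wider sector `a ≤ a₀_k`, `b₀_k ≤ b`.
[cite: HornJohnson2013, §7.1 (7.1.1b); BoydVandenberghe2004, §5.9.4 (5.98)] -/
theorem sectorCoeff_mono (k : κ) {a b : κ → ℝ} (ha : a k ≤ a₀ k) (hb : b₀ k ≤ b k) :
    0 ≤ dualSectorCoeff S D.Z₁₁ D.Z₂₁ D.Z₂₂ a b k :=
  D.toSlabDualWitness.sectorCoeff_mono k ha hb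

omit [DecidableEq ι] [DecidableEq κ] in
/-- **Slope monotonicity of the new `λ_k`-coefficient**: `2 s_k − a_k q_k ≥ 0` for every `a_k ≤ a₀_k`
(`q_k ≥ 0`). [cite: BoydVandenberghe2004, §5.9.4 (5.98) (nonnegativity against every primal cone direction)] -/
theorem lowerPopovCoeff_mono (k : κ) {a : κ → ℝ} (ha : a k ≤ a₀ k) :
    0 ≤ 2 * dualPopovCoeff S D.Z₂₁ D.Z₂₂ k - a k * dualLowerCoeff S D.Z₁₁ D.Z₂₁ k := by
  have h1 := D.lowerPopovCoeff_le k
  have h2 := mul_le_mul_of_nonneg_right ha (D.lowerCoeff_nonneg k)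
  linarith

/-- Channel `k` is NULL for the LP witness: the four functionals of the class-of-record witness vanish
AND `q_k = 0` (all decidable on rational data; automatic when the `k`-th row of `C` is zero).
[cite: BoydVandenberghe2004, §5.9.4 (5.98) (components of the dual point may vanish)] -/
def IsNull (k : κ) : Prop :=
  D.toSlabDualWitness.IsNull k ∧ dualLowerCoeff S D.Z₁₁ D.Z₂₁ k = 0

omit [DecidableEq ι] [DecidableEq κ] in
/-- A channel whose row of `C` vanishes and whose row of `Z₂₁` and diagonal entry of `Z₂₂` vanish is
NULL (the shape of a weightless diagonal channel of a directed presentation).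
[cite: BoydVandenberghe2004, §5.9.4 (5.98)] -/
theorem isNull_of_row_eq_zero {k : κ} (hC : S.C k = 0) (hZ : D.Z₂₁ k = 0) (hW : D.Z₂₂ k k = 0)
    (hCB : (S.C * S.B * D.Z₂₂) k k = 0) : D.IsNull k := by
  have hrow : ∀ (M : Matrix ι ι ℝ) (N : Matrix ι κ ℝ), (S.C * M * N) k k = 0 := by
    intro M N
    simp only [Matrix.mul_apply, hC, Pi.zero_apply, zero_mul, Finset.sum_const_zero]
  have hZrow : ∀ (N : Matrix ι κ ℝ), (D.Z₂₁ * N) k k = 0 := by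
    intro N
    simp only [Matrix.mul_apply, hZ, Pi.zero_apply, zero_mul, Finset.sum_const_zero]
  refine ⟨⟨?_, ?_, ?_, ?_⟩, ?_⟩
  · exact hrow _ _
  · exact hZrow _
  · exact hW
  · show (D.Z₂₁ * (S.C * S.A)ᵀ) k k - (S.C * S.B * D.Z₂₂) k k = 0
    rw [hZrow, hCB, sub_zero]
  · exact hrow _ _

end LPSlabDualWitness

/-! ## §3 The emptiness theorems for `LPSlabCertificate` -/

namespace LPSlabCertificate

variable {S : System ι κ} (Λ : LPSlabCertificate S)

/-- `lowerMatrix ⪰ 0` (`= (lowerMatrix − ε·1) + ε·1`, `ε > 0`).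
[cite: HornJohnson2013, Observation 7.1.3 (nonnegative combinations of positive semidefinite matrices)] -/
theorem posSemidef_lowerMatrix : Λ.lowerMatrix.PosSemidef := by
  have h := Λ.lowerMatrix_ge.add (Matrix.PosSemidef.one.smul Λ.ε_pos.le)
  simpa using h

/-- `lowerMatrix` is symmetric (`P = Pᵀ`, diagonal middle factor).
[cite: Khalil2002, §7.1.2 Theorem 7.3 (P = Pᵀ for the loop-transformed system)] -/
theorem lowerMatrix_transpose : Λ.lowerMatrixᵀ = Λ.lowerMatrix := by
  rw [Λ.lowerMatrix_def, Matrix.transpose_add, Λ.P_symm, Matrix.transpose_mul, Matrix.transpose_mul,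
    Matrix.transpose_transpose, Matrix.diagonal_transpose, Matrix.mul_assoc]

/-- `P = lowerMatrix − Cᵀ·diag(λa)·C`. [cite: Khalil2002, §7.1 Example 7.5 (loop transformation)] -/
theorem P_eq_lowerMatrix_sub :
    Λ.P = Λ.lowerMatrix - S.Cᵀ * diagonal (fun k => Λ.lam k * Λ.a k) * S.C := by
  rw [Λ.lowerMatrix_def, add_sub_cancel_right]

/-- **The `P`-term over the positivity cone**: `tr(P·W) ≥ −Σ_k λ_k a_k q_k` whenever `W + Wᵀ ⪰ 0`
(`tr(lowerMatrix·W) ≥ 0` by two PSD matrices, and the positivity block contributes `Σ_k λ_k a_k q_k`).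
[cite: BoydVandenberghe2004, §5.9.4 (dual function of (5.96)); HornJohnson2013, §7.1 Observation 7.1.3 / (7.1.1b) (`tr(PX) ≥ 0` for PSD `P, X`)] -/
theorem trace_P_mul_ge (Z₁₁ : Matrix ι ι ℝ) (Z₂₁ : Matrix κ ι ℝ)
    (hW : (dualAdjP S Z₁₁ Z₂₁ + (dualAdjP S Z₁₁ Z₂₁)ᵀ).PosSemidef) :
    -(∑ k, Λ.lam k * Λ.a k * dualLowerCoeff S Z₁₁ Z₂₁ k) ≤ trace (Λ.P * dualAdjP S Z₁₁ Z₂₁) := by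
  set W := dualAdjP S Z₁₁ Z₂₁
  have hLW : 0 ≤ trace (Λ.lowerMatrix * W) := by
    have h2 := Literature.Computation.Certificates.trace_mul_nonneg_of_posSemidef
      Λ.posSemidef_lowerMatrix hW
    have hsym : trace (Λ.lowerMatrix * Wᵀ) = trace (Λ.lowerMatrix * W) := by
      rw [← Matrix.trace_transpose, Matrix.transpose_mul, Matrix.transpose_transpose,
        Λ.lowerMatrix_transpose, Matrix.trace_mul_comm]
    rw [Matrix.mul_add, Matrix.trace_add, hsym] at h2
    linarith
  have hsplit : trace (Λ.P * W) = trace (Λ.lowerMatrix * W)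
      - ∑ k, Λ.lam k * Λ.a k * dualLowerCoeff S Z₁₁ Z₂₁ k := by
    rw [Λ.P_eq_lowerMatrix_sub, Matrix.sub_mul, Matrix.trace_sub, trace_lowerBlock_mul]
    rfl
  linarith

/-- **The emptiness theorem with null channels (weak alternative for the positivity class).**  If an
LP dual witness at slopes `(a₀, b₀)` exists and every channel is either NULL for it or carries a
certificate sector `a_k ≤ a₀_k`, `b₀_k ≤ b_k`, then NO `LPSlabCertificate S` exists:
`tr(Z·(−𝓛)) ≥ 0` (two PSD matrices) while the Lagrangian identity, `tr(P·W) ≥ −Σ λ_k a_k q_k`,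
(D2) and (D3′) give `tr(Z·𝓛) ≥ η·tr Z₁₁ > 0`.
[cite: BoydVandenberghe2004, §5.9.4 eqs. (5.97)–(5.98) and the displayed contradiction `0 < g(λ, ν) ≤ Σ λᵢᵀfᵢ(x) ≤ 0`; Example 5.14] -/
theorem false_of_lpDualWitness_of_null {a₀ b₀ : κ → ℝ} (D : LPSlabDualWitness S a₀ b₀)
    (hab : ∀ k, D.IsNull k ∨ (Λ.a k ≤ a₀ k ∧ b₀ k ≤ Λ.b k)) : False := by
  -- primal side: `tr(Z·𝓛) ≤ 0`
  have hneg : trace (fromBlocks D.Z₁₁ D.Z₂₁ᵀ D.Z₂₁ D.Z₂₂ *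
      slabMatrix S Λ.P Λ.η Λ.lam Λ.τ Λ.a Λ.b) ≤ 0 := by
    have h := Literature.Computation.Certificates.trace_mul_nonneg_of_posSemidef D.psd Λ.lmi
    rw [Matrix.mul_neg, Matrix.trace_neg] at h
    linarith
  -- dual side, term by term
  have hid := trace_dual_mul_slabMatrix S D.Z₁₁ D.Z₂₁ D.Z₂₂ D.toSlabDualWitness.Z₂₂_symm Λ.P Λ.η
    Λ.lam Λ.τ Λ.a Λ.b
  have hPW := Λ.trace_P_mul_ge D.Z₁₁ D.Z₂₁ D.adjP_psd
  have hη : 0 < Λ.η * trace D.Z₁₁ := mul_pos Λ.η_pos D.trace_pos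
  have hτ : 0 ≤ ∑ k, Λ.τ k * dualSectorCoeff S D.Z₁₁ D.Z₂₁ D.Z₂₂ Λ.a Λ.b k :=
    Finset.sum_nonneg fun k _ =>
      mul_nonneg (Λ.τ_nonneg k) (D.toSlabDualWitness.sectorCoeff_nonneg_of_null_or_slopes k
        ((hab k).imp_left And.left))
  have hl : 0 ≤ 2 * ∑ k, Λ.lam k * dualPopovCoeff S D.Z₂₁ D.Z₂₂ k
      - ∑ k, Λ.lam k * Λ.a k * dualLowerCoeff S D.Z₁₁ D.Z₂₁ k := by
    rw [Finset.mul_sum, ← Finset.sum_sub_distrib]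
    refine Finset.sum_nonneg fun k _ => ?_
    have hk : 2 * (Λ.lam k * dualPopovCoeff S D.Z₂₁ D.Z₂₂ k)
        - Λ.lam k * Λ.a k * dualLowerCoeff S D.Z₁₁ D.Z₂₁ k
        = Λ.lam k * (2 * dualPopovCoeff S D.Z₂₁ D.Z₂₂ k
            - Λ.a k * dualLowerCoeff S D.Z₁₁ D.Z₂₁ k) := by ring
    rw [hk]
    refine mul_nonneg (Λ.lam_nonneg k) ?_
    rcases hab k with hnull | ⟨ha, -⟩
    · have hs : dualPopovCoeff S D.Z₂₁ D.Z₂₂ k = 0 := hnull.1.2.2.2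
      rw [hs, hnull.2, mul_zero, mul_zero, sub_zero]
    · exact D.lowerPopovCoeff_mono k ha
  linarith

/-- **The emptiness theorem.**  If an LP dual witness at slopes `(a₀, b₀)` exists, NO
`LPSlabCertificate S` has channel sectors `a_k ≤ a₀_k`, `b₀_k ≤ b_k`.
[cite: BoydVandenberghe2004, §5.9.4 eqs. (5.97)–(5.98) and Example 5.14] -/
theorem false_of_lpDualWitness {a₀ b₀ : κ → ℝ} (D : LPSlabDualWitness S a₀ b₀)
    (ha : ∀ k, Λ.a k ≤ a₀ k) (hb : ∀ k, b₀ k ≤ Λ.b k) : False :=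
  Λ.false_of_lpDualWitness_of_null D fun k => Or.inr ⟨ha k, hb k⟩

/-- Set form: the class of LP certificates with sectors at least `[a₀, b₀]` is EMPTY.
[cite: BoydVandenberghe2004, §5.9.4 eqs. (5.97)–(5.98) and Example 5.14] -/
theorem isEmpty_of_lpDualWitness {a₀ b₀ : κ → ℝ} (D : LPSlabDualWitness S a₀ b₀) :
    IsEmpty {Λ : LPSlabCertificate S // (∀ k, Λ.a k ≤ a₀ k) ∧ ∀ k, b₀ k ≤ Λ.b k} :=
  ⟨fun ⟨Λ, ha, hb⟩ => Λ.false_of_lpDualWitness D ha hb⟩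

/-- **Window form.**  If an LP certificate satisfied the sector hypothesis of
`LPSlabCertificate.well_subset_regionOfAttraction` for the window `γ`, and the window contains angles
`ξa_k`, `ξb_k` with `cos ξa_k ≤ a₀_k`, `b₀_k ≤ cos ξb_k`, an LP dual witness at `(a₀, b₀)` refutes it
(and, the hypothesis being monotone in `γ`, every wider window).
[cite: BoydVandenberghe2004, §5.9.4 eqs. (5.97)–(5.98) and Example 5.14; Pai1981, §4.6 p. 117 (sector region of the power nonlinearity)] -/
theorem false_of_lpDualWitness_of_window {a₀ b₀ : κ → ℝ} (D : LPSlabDualWitness S a₀ b₀)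
    {γ : κ → ℝ}
    (hsec : ∀ k ξ, |ξ - S.δs k| ≤ γ k → Λ.a k ≤ Real.cos ξ ∧ Real.cos ξ ≤ Λ.b k)
    (ξa ξb : κ → ℝ) (hξa : ∀ k, |ξa k - S.δs k| ≤ γ k) (hξb : ∀ k, |ξb k - S.δs k| ≤ γ k)
    (hca : ∀ k, Real.cos (ξa k) ≤ a₀ k) (hcb : ∀ k, b₀ k ≤ Real.cos (ξb k)) : False :=
  Λ.false_of_lpDualWitness D (fun k => ((hsec k (ξa k) (hξa k)).1).trans (hca k))
    (fun k => (hcb k).trans (hsec k (ξb k) (hξb k)).2)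

/-- **Window form with null channels** (what a directed-presentation instance states): on every
non-null channel the window `|ξ − δ*_k| ≤ γ_k` contains angles `ξa_k`, `ξb_k` with
`cos ξa_k ≤ a₀_k`, `b₀_k ≤ cos ξb_k`; then no LP certificate satisfies the sector hypothesis of
`LPSlabCertificate.well_subset_regionOfAttraction` for the window `γ` (nor for any wider window).
[cite: BoydVandenberghe2004, §5.9.4 eqs. (5.97)–(5.98) and Example 5.14; Pai1981, §4.6 p. 117] -/
theorem false_of_lpDualWitness_of_window_of_null {a₀ b₀ : κ → ℝ} (D : LPSlabDualWitness S a₀ b₀)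
    {γ : κ → ℝ}
    (hsec : ∀ k ξ, |ξ - S.δs k| ≤ γ k → Λ.a k ≤ Real.cos ξ ∧ Real.cos ξ ≤ Λ.b k)
    (ξa ξb : κ → ℝ)
    (hwin : ∀ k, D.IsNull k ∨
      (|ξa k - S.δs k| ≤ γ k ∧ |ξb k - S.δs k| ≤ γ k ∧
        Real.cos (ξa k) ≤ a₀ k ∧ b₀ k ≤ Real.cos (ξb k))) : False := by
  refine Λ.false_of_lpDualWitness_of_null D fun k => ?_
  rcases hwin k with h | ⟨hξa, hξb, hca, hcb⟩
  · exact Or.inl h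
  · exact Or.inr ⟨((hsec k (ξa k) hξa).1).trans hca, hcb.trans (hsec k (ξb k) hξb).2⟩

/-- **Window form with per-channel existential window points** (the shape the rational tests of
`exists_window_point_cos_le` / `exists_window_point_le_cos` deliver): every channel is either NULL
for the witness or has window points `ξa`, `ξb` with `cos ξa ≤ a₀_k`, `b₀_k ≤ cos ξb`; then no LP
certificate satisfies the sector hypothesis for the window `γ`.
[cite: BoydVandenberghe2004, §5.9.4 eqs. (5.97)–(5.98) and Example 5.14; Pai1981, §4.6 p. 117] -/
theorem false_of_lpDualWitness_of_exists_window {a₀ b₀ : κ → ℝ} (D : LPSlabDualWitness S a₀ b₀)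
    {γ : κ → ℝ}
    (hsec : ∀ k ξ, |ξ - S.δs k| ≤ γ k → Λ.a k ≤ Real.cos ξ ∧ Real.cos ξ ≤ Λ.b k)
    (hwin : ∀ k, D.IsNull k ∨
      ((∃ ξ, |ξ - S.δs k| ≤ γ k ∧ Real.cos ξ ≤ a₀ k) ∧
        ∃ ξ, |ξ - S.δs k| ≤ γ k ∧ b₀ k ≤ Real.cos ξ)) : False := by
  refine Λ.false_of_lpDualWitness_of_null D fun k => ?_
  rcases hwin k with h | ⟨⟨ξa, hξa, hca⟩, ξb, hξb, hcb⟩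
  · exact Or.inl h
  · exact Or.inr ⟨((hsec k ξa hξa).1).trans hca, hcb.trans (hsec k ξb hξb).2⟩

/-- **Set form on a window**: for the window `γ` there is NO LP certificate satisfying the sector
hypothesis, given an LP dual witness with the window points (or null channels) as above.
[cite: BoydVandenberghe2004, §5.9.4 eqs. (5.97)–(5.98) and Example 5.14] -/
theorem not_exists_of_lpDualWitness_of_exists_window {a₀ b₀ : κ → ℝ}
    (D : LPSlabDualWitness S a₀ b₀) {γ : κ → ℝ}
    (hwin : ∀ k, D.IsNull k ∨
      ((∃ ξ, |ξ - S.δs k| ≤ γ k ∧ Real.cos ξ ≤ a₀ k) ∧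
        ∃ ξ, |ξ - S.δs k| ≤ γ k ∧ b₀ k ≤ Real.cos ξ)) :
    ¬ ∃ Λ : LPSlabCertificate S,
      ∀ k ξ, |ξ - S.δs k| ≤ γ k → Λ.a k ≤ Real.cos ξ ∧ Real.cos ξ ≤ Λ.b k :=
  fun ⟨Λ, hsec⟩ => Λ.false_of_lpDualWitness_of_exists_window D hsec hwin

end LPSlabCertificate

/-! ## §4 Consistency with the class of record -/

namespace SlabCertificate

variable {S : System ι κ} (Λ : SlabCertificate S)

/-- **An LP dual witness refutes the class of record too** (through `toSlabDualWitness`; equivalently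
through `SlabCertificate.toLP`, old class ⊆ positivity class).
[cite: BoydVandenberghe2004, §5.9.4 eqs. (5.97)–(5.98) and Example 5.14] -/
theorem false_of_lpDualWitness {a₀ b₀ : κ → ℝ} (D : LPSlabDualWitness S a₀ b₀)
    (ha : ∀ k, Λ.a k ≤ a₀ k) (hb : ∀ k, b₀ k ≤ Λ.b k) : False :=
  Λ.false_of_dualWitness D.toSlabDualWitness ha hb

/-- The same refutation obtained through the embedding `toLP` of the class of record into the
positivity class (the two roads agree). [cite: Khalil2002, §7.1 Example 7.5 (loop transformation)] -/
theorem false_of_lpDualWitness' {a₀ b₀ : κ → ℝ} (D : LPSlabDualWitness S a₀ b₀)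
    (ha : ∀ k, Λ.a k ≤ a₀ k) (hb : ∀ k, b₀ k ≤ Λ.b k) : False :=
  Λ.toLP.false_of_lpDualWitness D ha hb

/-- Window form with per-channel existential window points, for the class of record, from an LP
witness. [cite: BoydVandenberghe2004, §5.9.4 eqs. (5.97)–(5.98) and Example 5.14; Pai1981, §4.6 p. 117] -/
theorem false_of_lpDualWitness_of_exists_window {a₀ b₀ : κ → ℝ} (D : LPSlabDualWitness S a₀ b₀)
    {γ : κ → ℝ}
    (hsec : ∀ k ξ, |ξ - S.δs k| ≤ γ k → Λ.a k ≤ Real.cos ξ ∧ Real.cos ξ ≤ Λ.b k)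
    (hwin : ∀ k, D.IsNull k ∨
      ((∃ ξ, |ξ - S.δs k| ≤ γ k ∧ Real.cos ξ ≤ a₀ k) ∧
        ∃ ξ, |ξ - S.δs k| ≤ γ k ∧ b₀ k ≤ Real.cos ξ)) : False :=
  Λ.false_of_dualWitness_of_exists_window D.toSlabDualWitness hsec fun k =>
    (hwin k).imp_left And.left

end SlabCertificate

end Literature.MathematicalPhysics.PowerSystems.LyapunovFunctionFamily
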